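import Summits.CriticalPhenomena.PercolationContinuityZ3.Theorems.PercNearOneGluingAdditiveGluingAL5UpsetTransfer
import HarnessLib

/-! # Crux `PercNearOneGluing.AdditiveGluing` (stmt-CriticalPhenomena-4576) — AL5 for every block and every relay set,
# part D: ALL UP-SET INEQUALITIES of a relay star from the relay hypothesis (every `|T|`)

Support file (`--supports stmt-CriticalPhenomena-4576`; task png-dp-al5, gen 2); no definitions, no named facts.  Notation of
`…AL5UpsetTransfer.lean` (`π_J(u)`, `u_J = pinW u F J`, `M(v) = μ_v(x↔b) − μ_v(d↔b)`).

**Theorem (`al5u_upsets_of_hyp`) — "Lemma 3(i) for a star with a multi-vertex hypothesis".**  Let `F` be a star at `x` and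
suppose `μ_u(d↔b) ≤ μ_u(a↔b)` for every far endpoint `a` of `F` (`d ≠ x`).  Then for EVERY up-closed family `𝒰` of nonempty
patterns `J ⊆ F`: `Σ_{J∈𝒰} π_J(u) M(u_J) ≥ 0`; equivalently `μ_u(Q ∩ d↔b) ≤ μ_u(Q ∩ x↔b)` for every increasing event `Q` of the
star.  (`𝒰` = all nonempty patterns is the multi-edge Lemma 3 `multiEdge_lemma3`; `𝒰` = all patterns containing a fixed pair is
Kozma–Nitzan's Lemma 5.)

**Proof.** Induction on `|F|`.  If every singleton `{e}`, `e ∈ F`, lies in `𝒰` then `𝒰` is the family of all nonempty patterns and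
the claim is `multiEdge_lemma3` (pattern expansion `al5u_sum_nonempty_eq`).  Otherwise pick `e₀ = s(x,y) ∈ F` with `{e₀} ∉ 𝒰`, put
`F' = F ∖ e₀`, `𝒰₁ = {K ⊆ F' : K ∪ e₀ ∈ 𝒰}` (nonempty members!), `𝒰₀ = {K ⊆ F' : K ∈ 𝒰}`; splitting the sum according to
`e₀ ∈ J` and expanding `M(u_K^{F'})` along the weight `p = u(e₀)` (`al5_split_edge`) gives the bookkeeping identity
`Σ_{J∈𝒰} π_J M(u_J) = Σ_{K∈𝒰₀} π'_K M(u'_K) + p Σ_{K∈𝒰₁∖𝒰₀} π'_K M(u[e₀↦1]'_K)`, and the right-hand side is `≥ 0` by the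
transfer step `al5u_transfer` for the smaller star `F'` (same weighting `u`, induction hypothesis).
[cite: KozmaNitzan2024, Lemma 3(i) (pp. 6–7), Lemma 5 (p. 13); VandenbergHaggstromKahn2005, Thms. 1.3–1.4]
-/

namespace Summit.CriticalPhenomena.PercolationContinuityZ3.Theorems

open MeasureTheory Set
open Literature.Probability.LatticeModels (prodBernoulli)
open Literature.Probability.Percolation (BondConfig openConn openGraph openEdgeCluster pinW localCylinder
  DeterminedBy determinedBy_iff)

noncomputable section
open Classical

section AL5Upsets

open Filter Topology Literature.Probability.LatticeModels Literature.Probability.Percolation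

variable {n : ℕ}

/-- Removing the pair `e₀` from the star: pattern weight of `K ∪ e₀` (`K ⊆ F ∖ e₀`). [folklore] -/
theorem al5u_pi_insert (u : Sym2 (Fin n) → unitInterval) {F K : Finset (Sym2 (Fin n))} {e₀ : Sym2 (Fin n)}
    (hK : K ⊆ F.erase e₀) :
    (∏ e ∈ insert e₀ K, (u e : ℝ)) * ∏ e ∈ F \ insert e₀ K, (1 - (u e : ℝ)) =
      (u e₀ : ℝ) * ((∏ e ∈ K, (u e : ℝ)) * ∏ e ∈ F.erase e₀ \ K, (1 - (u e : ℝ))) := by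
  have he₀K : e₀ ∉ K := fun h => Finset.notMem_erase e₀ F (hK h)
  have hset : F \ insert e₀ K = F.erase e₀ \ K := by
    ext e
    simp only [Finset.mem_sdiff, Finset.mem_insert, Finset.mem_erase, not_or]
    tauto
  rw [Finset.prod_insert he₀K, hset]
  ring

/-- Removing the pair `e₀` from the star: pattern weight of `K` (`K ⊆ F ∖ e₀`). [folklore] -/
theorem al5u_pi_notMem (u : Sym2 (Fin n) → unitInterval) {F K : Finset (Sym2 (Fin n))} {e₀ : Sym2 (Fin n)} (he₀F : e₀ ∈ F)
    (hK : K ⊆ F.erase e₀) :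
    (∏ e ∈ K, (u e : ℝ)) * ∏ e ∈ F \ K, (1 - (u e : ℝ)) =
      (1 - (u e₀ : ℝ)) * ((∏ e ∈ K, (u e : ℝ)) * ∏ e ∈ F.erase e₀ \ K, (1 - (u e : ℝ))) := by
  have he₀K : e₀ ∉ K := fun h => Finset.notMem_erase e₀ F (hK h)
  have hset : F \ K = insert e₀ (F.erase e₀ \ K) := by
    ext e
    simp only [Finset.mem_sdiff, Finset.mem_insert, Finset.mem_erase]
    constructor
    · rintro ⟨heF, heK⟩
      by_cases h : e = e₀
      · exact Or.inl h
      · exact Or.inr ⟨⟨h, heF⟩, heK⟩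
    · rintro (rfl | ⟨⟨_, heF⟩, heK⟩)
      · exact ⟨he₀F, he₀K⟩
      · exact ⟨heF, heK⟩
  have hnot : e₀ ∉ F.erase e₀ \ K := fun h => Finset.notMem_erase e₀ F (Finset.mem_sdiff.1 h).1
  rw [hset, Finset.prod_insert hnot]
  ring

/-- Pinning `F` at `K ∪ e₀` is pinning `F ∖ e₀` at `K` in the weighting with `e₀` glued. [folklore] -/
theorem al5u_pinW_insert (u : Sym2 (Fin n) → unitInterval) {F K : Finset (Sym2 (Fin n))} {e₀ : Sym2 (Fin n)} (he₀F : e₀ ∈ F)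
    (hK : K ⊆ F.erase e₀) :
    pinW u (↑F : Set (Sym2 (Fin n))) ↑(insert e₀ K) =
      pinW (fun e' : Sym2 (Fin n) => if e' = e₀ then 1 else u e') (↑(F.erase e₀) : Set (Sym2 (Fin n))) ↑K := by
  have he₀K : e₀ ∉ K := fun h => Finset.notMem_erase e₀ F (hK h)
  funext e'
  by_cases h0 : e' = e₀
  · subst h0
    rw [pinW_apply_of_mem_of_mem u (Finset.mem_coe.2 he₀F) (Finset.mem_coe.2 (Finset.mem_insert_self _ _)),
      pinW_apply_of_not_mem _ _ (fun h => Finset.notMem_erase e' F (Finset.mem_coe.1 h)), if_pos rfl]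
  · by_cases heF : e' ∈ F
    · have heF' : e' ∈ (↑(F.erase e₀) : Set (Sym2 (Fin n))) := Finset.mem_coe.2 (Finset.mem_erase.2 ⟨h0, heF⟩)
      by_cases heK : e' ∈ K
      · rw [pinW_apply_of_mem_of_mem u (Finset.mem_coe.2 heF) (Finset.mem_coe.2 (Finset.mem_insert_of_mem heK)),
          pinW_apply_of_mem_of_mem _ heF' (Finset.mem_coe.2 heK)]
      · have hni : e' ∉ (↑(insert e₀ K) : Set (Sym2 (Fin n))) := fun h => by
          rcases Finset.mem_insert.1 (Finset.mem_coe.1 h) with h | h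
          · exact h0 h
          · exact heK h
        rw [pinW_apply_of_mem_of_not_mem u (Finset.mem_coe.2 heF) hni,
          pinW_apply_of_mem_of_not_mem _ heF' (fun h => heK (Finset.mem_coe.1 h))]
    · have heF' : e' ∉ (↑(F.erase e₀) : Set (Sym2 (Fin n))) := fun h => heF (Finset.mem_erase.1 (Finset.mem_coe.1 h)).2
      rw [pinW_apply_of_not_mem u _ (fun h => heF (Finset.mem_coe.1 h)), pinW_apply_of_not_mem _ _ heF', if_neg h0]

/-- Pinning `F` at `K ⊆ F ∖ e₀` is pinning `F ∖ e₀` at `K` in the weighting with `e₀` deleted. [folklore] -/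
theorem al5u_pinW_notMem (u : Sym2 (Fin n) → unitInterval) {F K : Finset (Sym2 (Fin n))} {e₀ : Sym2 (Fin n)} (he₀F : e₀ ∈ F)
    (hK : K ⊆ F.erase e₀) :
    pinW u (↑F : Set (Sym2 (Fin n))) ↑K =
      fun e' : Sym2 (Fin n) => if e' = e₀ then 0 else pinW u (↑(F.erase e₀) : Set (Sym2 (Fin n))) ↑K e' := by
  have he₀K : e₀ ∉ K := fun h => Finset.notMem_erase e₀ F (hK h)
  funext e'
  by_cases h0 : e' = e₀
  · subst h0
    rw [pinW_apply_of_mem_of_not_mem u (Finset.mem_coe.2 he₀F) (fun h => he₀K (Finset.mem_coe.1 h)), if_pos rfl]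
  · rw [if_neg h0]
    by_cases heF : e' ∈ F
    · have heF' : e' ∈ (↑(F.erase e₀) : Set (Sym2 (Fin n))) := Finset.mem_coe.2 (Finset.mem_erase.2 ⟨h0, heF⟩)
      by_cases heK : e' ∈ (↑K : Set (Sym2 (Fin n)))
      · rw [pinW_apply_of_mem_of_mem u (Finset.mem_coe.2 heF) heK, pinW_apply_of_mem_of_mem _ heF' heK]
      · rw [pinW_apply_of_mem_of_not_mem u (Finset.mem_coe.2 heF) heK, pinW_apply_of_mem_of_not_mem _ heF' heK]
    · have heF' : e' ∉ (↑(F.erase e₀) : Set (Sym2 (Fin n))) := fun h => heF (Finset.mem_erase.1 (Finset.mem_coe.1 h)).2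
      rw [pinW_apply_of_not_mem u _ (fun h => heF (Finset.mem_coe.1 h)), pinW_apply_of_not_mem _ _ heF']

/-- **All up-set inequalities of a relay star from the relay hypothesis** (see the module docstring): `F` a star at `x`,
`μ_u(d↔b) ≤ μ_u(a↔b)` for every far endpoint `a` (`d ≠ x`); then `Σ_{J∈𝒰} π_J(u) (μ_{u_J}(x↔b) − μ_{u_J}(d↔b)) ≥ 0` for every
up-closed family `𝒰` of nonempty patterns. [cite: KozmaNitzan2024, Lemma 3(i) (pp. 6–7), Lemma 5 (p. 13); VandenbergHaggstromKahn2005, Thms. 1.3–1.4] -/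
theorem al5u_upsets_of_hyp (u : Sym2 (Fin n) → unitInterval) (x d b : Fin n) (hdx : d ≠ x) :
    ∀ (F : Finset (Sym2 (Fin n))), (∀ e ∈ F, ∃ a, a ≠ x ∧ e = s(x, a)) →
      (∀ a : Fin n, a ≠ x → s(x, a) ∈ F → (prodBernoulli u).real (openConn d b) ≤ (prodBernoulli u).real (openConn a b)) →
      ∀ 𝒰 : Finset (Finset (Sym2 (Fin n))), 𝒰 ⊆ F.powerset → (∀ J ∈ 𝒰, J.Nonempty) →
        (∀ J ∈ 𝒰, ∀ J', J ⊆ J' → J' ⊆ F → J' ∈ 𝒰) →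
        0 ≤ ∑ J ∈ 𝒰, ((∏ e ∈ J, (u e : ℝ)) * ∏ e ∈ F \ J, (1 - (u e : ℝ))) *
          ((prodBernoulli (pinW u ↑F ↑J)).real (openConn x b) - (prodBernoulli (pinW u ↑F ↑J)).real (openConn d b)) := by
  suffices hmain : ∀ (m : ℕ) (F : Finset (Sym2 (Fin n))), F.card ≤ m → (∀ e ∈ F, ∃ a, a ≠ x ∧ e = s(x, a)) →
      (∀ a : Fin n, a ≠ x → s(x, a) ∈ F → (prodBernoulli u).real (openConn d b) ≤ (prodBernoulli u).real (openConn a b)) →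
      ∀ 𝒰 : Finset (Finset (Sym2 (Fin n))), 𝒰 ⊆ F.powerset → (∀ J ∈ 𝒰, J.Nonempty) →
        (∀ J ∈ 𝒰, ∀ J', J ⊆ J' → J' ⊆ F → J' ∈ 𝒰) →
        0 ≤ ∑ J ∈ 𝒰, ((∏ e ∈ J, (u e : ℝ)) * ∏ e ∈ F \ J, (1 - (u e : ℝ))) *
          ((prodBernoulli (pinW u ↑F ↑J)).real (openConn x b) - (prodBernoulli (pinW u ↑F ↑J)).real (openConn d b)) from
    fun F hF hyp => hmain F.card F le_rfl hF hyp
  intro m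
  induction m with
  | zero =>
    intro F hcard _ _ 𝒰 h𝒰F hne _
    have hF0 : F = ∅ := Finset.card_eq_zero.1 (Nat.le_zero.1 hcard)
    have h𝒰 : 𝒰 = ∅ := by
      refine Finset.eq_empty_of_forall_notMem fun J hJ => ?_
      have hJ0 : J ⊆ ∅ := hF0 ▸ Finset.mem_powerset.1 (h𝒰F hJ)
      exact (hne J hJ).ne_empty (Finset.subset_empty.1 hJ0)
    rw [h𝒰, Finset.sum_empty]
  | succ m ih =>
    intro F hcard hF hyp 𝒰 h𝒰F hne hup
    by_cases hall : ∀ e ∈ F, ({e} : Finset (Sym2 (Fin n))) ∈ 𝒰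
    · -- `𝒰` is the family of all nonempty patterns: the multi-edge Lemma 3
      have h𝒰eq : 𝒰 = F.powerset.filter (fun J => J.Nonempty) := by
        ext J
        constructor
        · intro hJ
          exact Finset.mem_filter.2 ⟨h𝒰F hJ, hne J hJ⟩
        · intro hJ
          obtain ⟨hJF, hJne⟩ := Finset.mem_filter.1 hJ
          have hJF' : J ⊆ F := Finset.mem_powerset.1 hJF
          obtain ⟨e, heJ⟩ := hJne
          exact hup {e} (hall e (hJF' heJ)) J (Finset.singleton_subset_iff.2 heJ) hJF'
      rw [h𝒰eq, al5u_sum_nonempty_eq u x d b F, sub_nonneg]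
      set T : Finset (Fin n) := Finset.univ.filter (fun a : Fin n => a ≠ x ∧ s(x, a) ∈ F) with hT
      have hxT : x ∉ T := fun h => (Finset.mem_filter.1 h).2.1 rfl
      have hle : ∀ a ∈ T, (prodBernoulli u).real (openConn d b) ≤ (prodBernoulli u).real (openConn a b) :=
        fun a ha => hyp a (Finset.mem_filter.1 ha).2.1 (Finset.mem_filter.1 ha).2.2
      have hR : {ω : Set (Sym2 (Fin n)) | ∃ a ∈ T, s(x, a) ∈ ω} = {ω | ∃ e ∈ F, e ∈ ω} := by
        ext ω
        simp only [Set.mem_setOf_eq]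
        constructor
        · rintro ⟨a, haT, ha⟩
          exact ⟨s(x, a), (Finset.mem_filter.1 haT).2.2, ha⟩
        · rintro ⟨e, heF, he⟩
          obtain ⟨a, hax, rfl⟩ := hF e heF
          exact ⟨a, Finset.mem_filter.2 ⟨Finset.mem_univ _, hax, heF⟩, he⟩
      have key := multiEdge_lemma3 u x d b T hxT hle
      rw [hR] at key
      exact key
    · -- remove a pair `e₀` whose singleton is not in `𝒰`
      obtain ⟨e₀, he₀⟩ := not_forall.1 hall
      obtain ⟨he₀F, he₀𝒰⟩ := Classical.not_imp.1 he₀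
      obtain ⟨y, hyx, he₀⟩ := hF e₀ he₀F
      set F' : Finset (Sym2 (Fin n)) := F.erase e₀ with hF'def
      have hF' : ∀ e ∈ F', ∃ a, a ≠ x ∧ e = s(x, a) := fun e he => hF e (Finset.mem_of_mem_erase he)
      have hyp' : ∀ a : Fin n, a ≠ x → s(x, a) ∈ F' →
          (prodBernoulli u).real (openConn d b) ≤ (prodBernoulli u).real (openConn a b) :=
        fun a hax ha => hyp a hax (Finset.mem_of_mem_erase ha)
      have hcard' : F'.card ≤ m := by
        have h1 : (F.erase e₀).card + 1 = F.card := Finset.card_erase_add_one he₀F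
        rw [← hF'def] at h1
        omega
      have hyF' : s(x, y) ∉ F' := by rw [← he₀]; exact Finset.notMem_erase e₀ F
      have IH := ih F' hcard' hF' hyp'
      -- the two families on the smaller star
      set 𝒰₁ : Finset (Finset (Sym2 (Fin n))) := F'.powerset.filter (fun K => insert e₀ K ∈ 𝒰) with h𝒰₁
      set 𝒰₀ : Finset (Finset (Sym2 (Fin n))) := F'.powerset.filter (fun K => K ∈ 𝒰) with h𝒰₀
      have h01 : 𝒰₀ ⊆ 𝒰₁ := by
        intro K hK
        obtain ⟨hKF', hK𝒰⟩ := Finset.mem_filter.1 hK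
        have hKF'' : K ⊆ F' := Finset.mem_powerset.1 hKF'
        refine Finset.mem_filter.2 ⟨hKF', hup K hK𝒰 _ (Finset.subset_insert _ _) ?_⟩
        exact Finset.insert_subset he₀F (hKF''.trans (Finset.erase_subset _ _))
      have h1F : 𝒰₁ ⊆ F'.powerset := Finset.filter_subset _ _
      have hne1 : ∀ K ∈ 𝒰₁, K.Nonempty := by
        intro K hK
        rw [Finset.nonempty_iff_ne_empty]
        rintro rfl
        exact he₀𝒰 (by simpa using (Finset.mem_filter.1 hK).2)
      have hup0' : ∀ K ∈ 𝒰₀, ∀ K', K ⊆ K' → K' ⊆ F' → K' ∈ 𝒰₀ := by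
        intro K hK K' hKK' hK'
        exact Finset.mem_filter.2 ⟨Finset.mem_powerset.2 hK',
          hup K (Finset.mem_filter.1 hK).2 K' hKK' (hK'.trans (Finset.erase_subset _ _))⟩
      have hup1' : ∀ K ∈ 𝒰₁, ∀ K', K ⊆ K' → K' ⊆ F' → K' ∈ 𝒰₁ := by
        intro K hK K' hKK' hK'
        refine Finset.mem_filter.2 ⟨Finset.mem_powerset.2 hK', hup _ (Finset.mem_filter.1 hK).2 _
          (Finset.insert_subset_insert e₀ hKK') ?_⟩
        exact Finset.insert_subset he₀F (hK'.trans (Finset.erase_subset _ _))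
      have hp0 : 0 ≤ (u e₀ : ℝ) := unitInterval.nonneg _
      have hp1 : (u e₀ : ℝ) ≤ 1 := unitInterval.le_one _
      have key := al5u_transfer u x y d b F' hF' hyx hyF' hdx IH 𝒰₀ 𝒰₁ h01 h1F hne1 hup0' hup1' (u e₀ : ℝ) hp0 hp1
      rw [← he₀] at key
      -- bookkeeping: the sum over `𝒰` equals the mixed sum
      set u1 : Sym2 (Fin n) → unitInterval := fun e' => if e' = e₀ then 1 else u e' with hu1
      set π : Finset (Sym2 (Fin n)) → ℝ := fun J => (∏ e ∈ J, (u e : ℝ)) * ∏ e ∈ F \ J, (1 - (u e : ℝ)) with hπ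
      set π' : Finset (Sym2 (Fin n)) → ℝ := fun K => (∏ e ∈ K, (u e : ℝ)) * ∏ e ∈ F' \ K, (1 - (u e : ℝ)) with hπ'
      set M : (Sym2 (Fin n) → unitInterval) → ℝ := fun v =>
        (prodBernoulli v).real (openConn x b) - (prodBernoulli v).real (openConn d b) with hM
      have hsplitM : ∀ K, K ⊆ F' → M (pinW u ↑F' ↑K) =
          (u e₀ : ℝ) * M (pinW u1 ↑F' ↑K) + (1 - (u e₀ : ℝ)) * M (pinW u ↑F ↑K) := by
        intro K hK
        have hw : (pinW u (↑F' : Set (Sym2 (Fin n))) ↑K) e₀ = u e₀ :=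
          pinW_apply_of_not_mem u _ (fun h => Finset.notMem_erase e₀ F (Finset.mem_coe.1 h))
        have h1 := al5_split_edge (pinW u ↑F' ↑K) e₀ (openConn x b)
        have h2 := al5_split_edge (pinW u ↑F' ↑K) e₀ (openConn d b)
        rw [hw] at h1 h2
        have hg : (fun e' : Sym2 (Fin n) => if e' = e₀ then (1 : unitInterval) else pinW u (↑F' : Set (Sym2 (Fin n))) ↑K e') =
            pinW u1 ↑F' ↑K := (al5u_pinW_glue_comm u F' (Finset.notMem_erase e₀ F) K).symm
        have hd : (fun e' : Sym2 (Fin n) => if e' = e₀ then (0 : unitInterval) else pinW u (↑F' : Set (Sym2 (Fin n))) ↑K e') =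
            pinW u ↑F ↑K := (al5u_pinW_notMem u he₀F hK).symm
        rw [hg, hd] at h1 h2
        simp only [hM]
        rw [h1, h2]
        ring
      -- split the sum over `𝒰` according to `e₀ ∈ J`
      have hfilt0 : 𝒰.filter (fun J => e₀ ∉ J) = 𝒰₀ := by
        ext K
        simp only [Finset.mem_filter, h𝒰₀, Finset.mem_powerset]
        constructor
        · rintro ⟨hK𝒰, hK⟩
          exact ⟨Finset.subset_erase.2 ⟨Finset.mem_powerset.1 (h𝒰F hK𝒰), hK⟩, hK𝒰⟩
        · rintro ⟨hKF', hK𝒰⟩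
          exact ⟨hK𝒰, fun h => Finset.notMem_erase e₀ F (hKF' h)⟩
      have hfilt1 : 𝒰.filter (fun J => e₀ ∈ J) = 𝒰₁.image (insert e₀) := by
        ext J
        simp only [Finset.mem_filter, Finset.mem_image, h𝒰₁, Finset.mem_powerset]
        constructor
        · rintro ⟨hJ𝒰, hJ⟩
          refine ⟨J.erase e₀, ⟨Finset.erase_subset_erase e₀ (Finset.mem_powerset.1 (h𝒰F hJ𝒰)), ?_⟩, Finset.insert_erase hJ⟩
          rw [Finset.insert_erase hJ]
          exact hJ𝒰
        · rintro ⟨K, ⟨_, hK𝒰⟩, rfl⟩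
          exact ⟨hK𝒰, Finset.mem_insert_self _ _⟩
      have hinj : ∀ K ∈ 𝒰₁, ∀ K' ∈ 𝒰₁, insert e₀ K = insert e₀ K' → K = K' := by
        intro K hK K' hK' hKK'
        have hKe : e₀ ∉ K := fun h => Finset.notMem_erase e₀ F (Finset.mem_powerset.1 (h1F hK) h)
        have hK'e : e₀ ∉ K' := fun h => Finset.notMem_erase e₀ F (Finset.mem_powerset.1 (h1F hK') h)
        rw [← Finset.erase_insert hKe, hKK', Finset.erase_insert hK'e]
      have hsum : ∑ J ∈ 𝒰, π J * M (pinW u ↑F ↑J) =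
          ∑ K ∈ 𝒰₀, π' K * M (pinW u ↑F' ↑K) + (u e₀ : ℝ) * ∑ K ∈ 𝒰₁ \ 𝒰₀, π' K * M (pinW u1 ↑F' ↑K) := by
        rw [← Finset.sum_filter_add_sum_filter_not 𝒰 (fun J => e₀ ∈ J), hfilt1, hfilt0, Finset.sum_image hinj]
        have hA : ∑ K ∈ 𝒰₁, π (insert e₀ K) * M (pinW u ↑F ↑(insert e₀ K)) =
            (u e₀ : ℝ) * ∑ K ∈ 𝒰₁, π' K * M (pinW u1 ↑F' ↑K) := by
          rw [Finset.mul_sum]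
          refine Finset.sum_congr rfl fun K hK => ?_
          have hKF' : K ⊆ F' := Finset.mem_powerset.1 (h1F hK)
          simp only [hπ, hπ']
          rw [al5u_pi_insert u hKF', al5u_pinW_insert u he₀F hKF']
          ring
        have hB : ∑ K ∈ 𝒰₀, π K * M (pinW u ↑F ↑K) =
            ∑ K ∈ 𝒰₀, π' K * M (pinW u ↑F' ↑K) - (u e₀ : ℝ) * ∑ K ∈ 𝒰₀, π' K * M (pinW u1 ↑F' ↑K) := by
          rw [Finset.mul_sum, ← Finset.sum_sub_distrib]
          refine Finset.sum_congr rfl fun K hK => ?_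
          have hKF' : K ⊆ F' := Finset.mem_powerset.1 (h1F (h01 hK))
          simp only [hπ, hπ']
          rw [al5u_pi_notMem u he₀F hKF', hsplitM K hKF']
          ring
        rw [hA, hB, Finset.sum_sdiff_eq_sub h01]
        ring
      simp only [hπ, hM] at hsum
      rw [hsum]
      simpa only [hπ', hu1] using key

end AL5Upsets

end

end Summit.CriticalPhenomena.PercolationContinuityZ3.Theorems
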